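import Mathlib.Tactic
import HarnessLib
import HarnessLib.Audit.Tags
import Summits.CriticalPhenomena.PercolationContinuityZ3.Theorems.PercNearOneGluingNoHeavyLowerTailSahiPartitionDaykinCredit

/-!
# The rainbow lemma: comparable members pay for themselves; the antichain core

Support file (seat `prim-masterthm-p1`, gen 34; `--supports stmt-CriticalPhenomena-4575`).  Theorems over `…SahiPartitionDaykin`
(`rainbowMeets`, `RainbowMeetCojoin`); no `sorry`, standard axioms.  Memo
`run/shared/lean/prim/prim-masterthm/FROM-prim-masterthm-p1-g34-ISOLATED-AND-ANTICHAINS.md`.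

SETTING.  `P ⊆ 2^F` complement-free (`F \ S ∉ P` for `S ∈ P`); `rainbowMeets F P = {∅} ∪ {a ∩ b : a ≠ b} ∪ {F \ (a ∪ b) : a ≠ b}`; the rainbow
lemma `RainbowMeetCojoin` (OPEN) asks `#P ≤ #rainbowMeets F P`.

NEW HERE ([this work], gen 34).
* **Comparable members pay for themselves.**  Call `a ∈ P` COMPARABLE if `a ⊆ b` or `b ⊆ a` for some other member `b`, ISOLATED otherwise
  (`compMembers`, `isoMembers`, a partition of `P`).  A comparable member `a` owns the rainbow meet `compColour F P a` = `a` itself if `a ⊊ b ∈ P`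
  (then `a = a ∩ b`), else `F \ a` (then `a ⊋ b ∈ P` and `F \ a = F \ (a ∪ b)`); by complement-freeness these colours are pairwise distinct and lie in
  `compMembers P ∪ σ(compMembers P)`.  Hence (`card_compMembers_add_le_card_rainbowMeets`)
  `#compMembers P + #(rainbowMeets F P \ (compMembers ∪ σ compMembers)) ≤ #rainbowMeets F P`.
* **THEOREM (`card_le_card_rainbowMeets_of_card_isoMembers_le_one`).**  The rainbow lemma holds for every complement-free family with AT MOST ONE
  isolated member (the one isolated member is paid by `∅`, which is a rainbow meet and is neither a comparable member nor the complement of one).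
  Corollaries: the rainbow lemma holds whenever `∅ ∈ P` or `F ∈ P` (`…_of_empty_mem`, `…_of_top_mem`).
* **The antichain core.**  `rainbowMeetCojoin_of_isolatedRainbow`: the rainbow lemma follows from `IsolatedRainbow` — "the isolated members are paid by
  rainbow meets outside `compMembers ∪ σ compMembers`" — which is EXHAUSTIVELY TRUE on `2^4` (6 561 families) and `2^5` (43 046 721 families), tight only
  for `#P ≤ 2` (engines `prim-masterthm-p1/code-g34/iso5.c`, `iso5b.c`).  For an antichain every member is isolated, so the core case is the rainbow
  lemma for complement-free ANTICHAINS, for which the UNTWISTED statement `AntichainMeetsOrJoins` (`max(#({∅} ∪ meets), #({F} ∪ joins)) ≥ #P`,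
  exhaustive on all antichains of `2^n`, `n ≤ 5`, and 6·10⁵ sampled antichains of `2^6`) already suffices (`card_le_card_rainbowMeets_of_antichainMeetsOrJoins`).
HONEST FRAMING: `RainbowMeetCojoin`, `IsolatedRainbow`, `AntichainMeetsOrJoins` remain OPEN (typed conjectures with evidence); the theorems here are
unconditional. [this work]
-/

namespace Summit.CriticalPhenomena.PercolationContinuityZ3.Theorems.SahiColouredDaykin

open Finset

variable {α : Type*} [DecidableEq α]

/-! ### 1. Comparable and isolated members -/

/-- The COMPARABLE members of `P`: those contained in, or containing, some other member. [this work] -/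
def compMembers (P : Finset (Finset α)) : Finset (Finset α) :=
  P.filter fun a => ∃ b ∈ P, b ≠ a ∧ (a ⊆ b ∨ b ⊆ a)

/-- The ISOLATED members of `P`: those incomparable to every other member. [this work] -/
def isoMembers (P : Finset (Finset α)) : Finset (Finset α) :=
  P.filter fun a => ¬∃ b ∈ P, b ≠ a ∧ (a ⊆ b ∨ b ⊆ a)

/-- Unpacking `compMembers`. [this work] -/
theorem mem_compMembers_iff {P : Finset (Finset α)} {a : Finset α} :
    a ∈ compMembers P ↔ a ∈ P ∧ ∃ b ∈ P, b ≠ a ∧ (a ⊆ b ∨ b ⊆ a) := by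
  unfold compMembers; rw [mem_filter]

/-- Unpacking `isoMembers`. [this work] -/
theorem mem_isoMembers_iff {P : Finset (Finset α)} {a : Finset α} :
    a ∈ isoMembers P ↔ a ∈ P ∧ ∀ b ∈ P, b ≠ a → ¬(a ⊆ b ∨ b ⊆ a) := by
  unfold isoMembers
  rw [mem_filter]
  constructor
  · rintro ⟨haP, h⟩
    exact ⟨haP, fun b hb hba hab => h ⟨b, hb, hba, hab⟩⟩
  · rintro ⟨haP, h⟩
    exact ⟨haP, fun ⟨b, hb, hba, hab⟩ => h b hb hba hab⟩

/-- Comparable members are members. [this work] -/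
theorem compMembers_subset (P : Finset (Finset α)) : compMembers P ⊆ P := filter_subset _ _

/-- Isolated members are members. [this work] -/
theorem isoMembers_subset (P : Finset (Finset α)) : isoMembers P ⊆ P := filter_subset _ _

/-- Every member is comparable or isolated, not both: the cardinalities add up. [this work] -/
theorem card_compMembers_add_card_isoMembers (P : Finset (Finset α)) :
    #(compMembers P) + #(isoMembers P) = #P := by
  unfold compMembers isoMembers
  rw [Finset.card_filter_add_card_filter_not]

/-! ### 2. The colour owned by a comparable member -/

/-- The rainbow meet owned by a comparable member `a`: `a` itself if `a` lies below another member, else `F \ a`. [this work] -/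
def compColour (F : Finset α) (P : Finset (Finset α)) (a : Finset α) : Finset α :=
  if ∃ b ∈ P, b ≠ a ∧ a ⊆ b then a else F \ a

/-- The colour of a comparable member is a rainbow meet (`a = a ∩ b` if `a ⊊ b`, `F \ a = F \ (a ∪ b)` if `a ⊋ b`). [this work] -/
theorem compColour_mem_rainbowMeets {F : Finset α} {P : Finset (Finset α)} {a : Finset α}
    (ha : a ∈ compMembers P) : compColour F P a ∈ rainbowMeets F P := by
  obtain ⟨haP, b, hbP, hba, hab⟩ := mem_compMembers_iff.1 ha
  unfold compColour
  by_cases h : ∃ b ∈ P, b ≠ a ∧ a ⊆ b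
  · rw [if_pos h]
    obtain ⟨c, hcP, hca, hac⟩ := h
    have e : a = a ∩ c := (inter_eq_left.2 hac).symm
    rw [e]
    exact inter_mem_rainbowMeets haP hcP (Ne.symm hca)
  · rw [if_neg h]
    rcases hab with hab | hba'
    · exact absurd ⟨b, hbP, hba, hab⟩ h
    · have e : F \ a = F \ (a ∪ b) := by rw [union_eq_left.2 hba']
      rw [e]
      exact sdiff_union_mem_rainbowMeets haP hbP (Ne.symm hba)

/-- The colour of a member lies in `P ∪ σP` restricted to comparable members: it is `a` or `F \ a`. [this work] -/
theorem compColour_mem_union {F : Finset α} {P : Finset (Finset α)} {a : Finset α} (ha : a ∈ compMembers P) :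
    compColour F P a ∈ compMembers P ∪ (compMembers P).image (fun S => F \ S) := by
  unfold compColour
  split_ifs
  · exact mem_union_left _ ha
  · exact mem_union_right _ (mem_image_of_mem _ ha)

/-- For a complement-free family of subsets of `F`, `compColour F P` is injective on `P`. [this work] -/
theorem compColour_injOn {F : Finset α} {P : Finset (Finset α)}
    (hPF : ∀ S ∈ P, S ⊆ F) (hcf : ∀ S ∈ P, F \ S ∉ P) :
    Set.InjOn (compColour F P) (P : Set (Finset α)) := by
  intro a ha b hb hab
  simp only [mem_coe] at ha hb
  unfold compColour at hab
  by_cases h1 : ∃ c ∈ P, c ≠ a ∧ a ⊆ c <;> by_cases h2 : ∃ c ∈ P, c ≠ b ∧ b ⊆ c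
  · rwa [if_pos h1, if_pos h2] at hab
  · rw [if_pos h1, if_neg h2] at hab
    exact absurd (hab ▸ ha) (hcf b hb)
  · rw [if_neg h1, if_pos h2] at hab
    exact absurd (hab.symm ▸ hb) (hcf a ha)
  · rw [if_neg h1, if_neg h2] at hab
    have ea : F \ (F \ a) = a := Finset.sdiff_sdiff_eq_self (hPF a ha)
    have eb : F \ (F \ b) = b := Finset.sdiff_sdiff_eq_self (hPF b hb)
    rw [← ea, ← eb, hab]

/-- **Comparable members pay for themselves.**  For complement-free `P ⊆ 2^F`:
`#compMembers P + #(rainbowMeets F P \ (compMembers P ∪ σ compMembers P)) ≤ #rainbowMeets F P`. [this work] -/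
theorem card_compMembers_add_le_card_rainbowMeets (F : Finset α) (P : Finset (Finset α))
    (hPF : ∀ S ∈ P, S ⊆ F) (hcf : ∀ S ∈ P, F \ S ∉ P) :
    #(compMembers P) + #(rainbowMeets F P \ (compMembers P ∪ (compMembers P).image (fun S => F \ S))) ≤
      #(rainbowMeets F P) := by
  set C := compMembers P with hC
  set K := C.image (compColour F P) with hK
  have hKcard : #K = #C := by
    rw [hK]
    exact card_image_of_injOn ((compColour_injOn hPF hcf).mono (coe_subset.2 (compMembers_subset P)))
  have hKsub : K ⊆ rainbowMeets F P := by
    intro Z hZ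
    obtain ⟨a, ha, rfl⟩ := mem_image.1 hZ
    exact compColour_mem_rainbowMeets ha
  have hKin : K ⊆ C ∪ C.image (fun S => F \ S) := by
    intro Z hZ
    obtain ⟨a, ha, rfl⟩ := mem_image.1 hZ
    exact compColour_mem_union ha
  have hdisj : Disjoint K (rainbowMeets F P \ (C ∪ C.image (fun S => F \ S))) := by
    rw [disjoint_left]
    intro Z hZK hZ
    exact (mem_sdiff.1 hZ).2 (hKin hZK)
  have hsub : K ∪ (rainbowMeets F P \ (C ∪ C.image (fun S => F \ S))) ⊆ rainbowMeets F P :=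
    union_subset hKsub sdiff_subset
  calc #C + #(rainbowMeets F P \ (C ∪ C.image (fun S => F \ S)))
      = #(K ∪ (rainbowMeets F P \ (C ∪ C.image (fun S => F \ S)))) := by
        rw [card_union_of_disjoint hdisj, hKcard]
    _ ≤ #(rainbowMeets F P) := card_le_card hsub

/-! ### 3. The rainbow lemma with at most one isolated member -/

/-- If `P` has at least two members and an isolated member, then `∅ ∉ P`. [this work] -/
theorem empty_not_mem_of_isoMembers_nonempty {P : Finset (Finset α)} {i : Finset α}
    (hi : i ∈ isoMembers P) (h2 : 2 ≤ #P) : (∅ : Finset α) ∉ P := by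
  intro h0
  obtain ⟨hiP, hiso⟩ := mem_isoMembers_iff.1 hi
  by_cases hi0 : i = ∅
  · -- `i = ∅` is below every other member, and there is one
    subst hi0
    obtain ⟨b, hbP, hb⟩ : ∃ b ∈ P, b ≠ (∅ : Finset α) := by
      by_contra hcon
      push Not at hcon
      have : P ⊆ {∅} := fun b hb => mem_singleton.2 (hcon b hb)
      have := card_le_card this
      rw [card_singleton] at this
      omega
    exact hiso b hbP hb (Or.inl (empty_subset b))
  · exact hiso ∅ h0 (Ne.symm hi0) (Or.inr (empty_subset i))

/-- If `P ⊆ 2^F` has at least two members and an isolated member, then `F ∉ P`. [this work] -/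
theorem top_not_mem_of_isoMembers_nonempty {F : Finset α} {P : Finset (Finset α)} {i : Finset α}
    (hPF : ∀ S ∈ P, S ⊆ F) (hi : i ∈ isoMembers P) (h2 : 2 ≤ #P) : F ∉ P := by
  intro hF
  obtain ⟨hiP, hiso⟩ := mem_isoMembers_iff.1 hi
  by_cases hiF : i = F
  · subst hiF
    obtain ⟨b, hbP, hb⟩ : ∃ b ∈ P, b ≠ i := by
      by_contra hcon
      push Not at hcon
      have : P ⊆ {i} := fun b hb => mem_singleton.2 (hcon b hb)
      have := card_le_card this
      rw [card_singleton] at this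
      omega
    exact hiso b hbP hb (Or.inr (hPF b hbP))
  · exact hiso F hF (Ne.symm hiF) (Or.inl (hPF i hiP))

/-- **THEOREM.  The rainbow lemma holds for every complement-free family with at most one isolated member.**
(Comparable members pay for themselves; a single isolated member is paid by `∅`.) [this work] -/
theorem card_le_card_rainbowMeets_of_card_isoMembers_le_one (F : Finset α) (P : Finset (Finset α))
    (hPF : ∀ S ∈ P, S ⊆ F) (hcf : ∀ S ∈ P, F \ S ∉ P) (h1 : #(isoMembers P) ≤ 1) :
    #P ≤ #(rainbowMeets F P) := by
  have hsplit := card_compMembers_add_card_isoMembers P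
  have hmain := card_compMembers_add_le_card_rainbowMeets F P hPF hcf
  have h0 : ∅ ∈ rainbowMeets F P := mem_rainbowMeets_iff.2 (Or.inl rfl)
  rcases Nat.lt_or_ge (#(isoMembers P)) 1 with hlt | hge
  · -- no isolated member
    omega
  · -- exactly one isolated member
    have hone : #(isoMembers P) = 1 := le_antisymm h1 hge
    obtain ⟨i, hi⟩ := card_eq_one.1 hone
    have hiI : i ∈ isoMembers P := by rw [hi]; exact mem_singleton_self i
    by_cases h2 : 2 ≤ #P
    · -- `∅` is a rainbow meet outside `C ∪ σC`
      have hE : (∅ : Finset α) ∉ P := empty_not_mem_of_isoMembers_nonempty hiI h2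
      have hT : F ∉ P := top_not_mem_of_isoMembers_nonempty hPF hiI h2
      have hout : (∅ : Finset α) ∈ rainbowMeets F P \ (compMembers P ∪ (compMembers P).image (fun S => F \ S)) := by
        refine mem_sdiff.2 ⟨h0, ?_⟩
        intro h
        rcases mem_union.1 h with h | h
        · exact hE (compMembers_subset P h)
        · obtain ⟨c, hc, hce⟩ := mem_image.1 h
          have hcP := compMembers_subset P hc
          have : c = F := by
            have hcF := hPF c hcP
            have : F \ c = ∅ := hce
            exact Subset.antisymm hcF (sdiff_eq_empty_iff_subset.1 this)
          exact hT (this ▸ hcP)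
      have : 1 ≤ #(rainbowMeets F P \ (compMembers P ∪ (compMembers P).image (fun S => F \ S))) :=
        card_pos.2 ⟨∅, hout⟩
      omega
    · -- `#P ≤ 1 ≤ #rainbowMeets`
      have : 1 ≤ #(rainbowMeets F P) := card_pos.2 ⟨∅, h0⟩
      omega

/-- **COROLLARY.**  The rainbow lemma holds for every complement-free family containing `∅`. [this work] -/
theorem card_le_card_rainbowMeets_of_empty_mem (F : Finset α) (P : Finset (Finset α))
    (hPF : ∀ S ∈ P, S ⊆ F) (hcf : ∀ S ∈ P, F \ S ∉ P) (h0 : (∅ : Finset α) ∈ P) :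
    #P ≤ #(rainbowMeets F P) := by
  refine card_le_card_rainbowMeets_of_card_isoMembers_le_one F P hPF hcf ?_
  -- every member other than `∅` is comparable to `∅`; so `isoMembers P ⊆ {∅}`
  have : isoMembers P ⊆ {∅} := by
    intro a ha
    obtain ⟨haP, hiso⟩ := mem_isoMembers_iff.1 ha
    rw [mem_singleton]
    by_contra hne
    exact hiso ∅ h0 (Ne.symm hne) (Or.inr (empty_subset a))
  exact (card_le_card this).trans (by rw [card_singleton])

/-- **COROLLARY.**  The rainbow lemma holds for every complement-free family of subsets of `F` containing `F`. [this work] -/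
theorem card_le_card_rainbowMeets_of_top_mem (F : Finset α) (P : Finset (Finset α))
    (hPF : ∀ S ∈ P, S ⊆ F) (hcf : ∀ S ∈ P, F \ S ∉ P) (hF : F ∈ P) :
    #P ≤ #(rainbowMeets F P) := by
  refine card_le_card_rainbowMeets_of_card_isoMembers_le_one F P hPF hcf ?_
  have : isoMembers P ⊆ {F} := by
    intro a ha
    obtain ⟨haP, hiso⟩ := mem_isoMembers_iff.1 ha
    rw [mem_singleton]
    by_contra hne
    exact hiso F hF (Ne.symm hne) (Or.inl (hPF a haP))
  exact (card_le_card this).trans (by rw [card_singleton])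

/-! ### 4. The antichain core (typed conjectures and reductions) -/

/-- **CONJECTURE (isolated members are paid outside the comparable classes; typed).**  For complement-free `P ⊆ 2^F`, the isolated members
are at most as many as the rainbow meets lying outside `compMembers P ∪ σ(compMembers P)`.  Exhaustively true on `2^4` and `2^5`
(43 046 721 families; tight only for `#P ≤ 2`); implies `RainbowMeetCojoin` (`rainbowMeetCojoin_of_isolatedRainbow`). [this work] [status: open] -/
@[conjecture] def IsolatedRainbow (α : Type*) [DecidableEq α] : Prop :=
  ∀ (F : Finset α) (P : Finset (Finset α)), (∀ S ∈ P, S ⊆ F) → (∀ S ∈ P, F \ S ∉ P) →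
    #(isoMembers P) ≤ #(rainbowMeets F P \ (compMembers P ∪ (compMembers P).image (fun S => F \ S)))

/-- **`IsolatedRainbow ⟹ RainbowMeetCojoin`.** [this work] -/
theorem rainbowMeetCojoin_of_isolatedRainbow (h : IsolatedRainbow α) : RainbowMeetCojoin α := by
  intro F P hPF hcf
  have h1 := card_compMembers_add_card_isoMembers P
  have h2 := card_compMembers_add_le_card_rainbowMeets F P hPF hcf
  have h3 := h F P hPF hcf
  omega

/-- **CONJECTURE (antichains have many meets or many joins; typed, untwisted).**  For a complement-free ANTICHAIN `P ⊆ 2^F`: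
`#P ≤ #({∅} ∪ {a ∩ b : a ≠ b})` or `#P ≤ #({F} ∪ {a ∪ b : a ≠ b})`.  Exhaustively true for all antichains of `2^n`, `n ≤ 5` (with the
stronger hypothesis-free form `#meets + #joins ≥ 2 #P − 2` for EVERY antichain with `#P ≥ 2`), and on 6·10⁵ sampled antichains of `2^6`;
false for general complement-free families (`{0,1,01,2,02,12}`).  Implies the rainbow lemma for antichains
(`card_le_card_rainbowMeets_of_antichainMeetsOrJoins`). [this work] [status: open] -/
@[conjecture] def AntichainMeetsOrJoins (α : Type*) [DecidableEq α] : Prop :=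
  ∀ (F : Finset α) (P : Finset (Finset α)), (∀ S ∈ P, S ⊆ F) → (∀ S ∈ P, F \ S ∉ P) → IsAntichain (· ⊆ ·) (P : Set (Finset α)) →
    #P ≤ #(insert ∅ (P.offDiag.image fun pq => pq.1 ∩ pq.2)) ∨ #P ≤ #(insert F (P.offDiag.image fun pq => pq.1 ∪ pq.2))

/-- Meets of distinct members, with `∅`, are rainbow meets. [this work] -/
theorem insert_empty_image_inter_subset_rainbowMeets (F : Finset α) (P : Finset (Finset α)) :
    insert ∅ (P.offDiag.image fun pq => pq.1 ∩ pq.2) ⊆ rainbowMeets F P := by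
  intro Z hZ
  rcases mem_insert.1 hZ with rfl | hZ
  · exact mem_rainbowMeets_iff.2 (Or.inl rfl)
  · obtain ⟨⟨a, b⟩, hab, rfl⟩ := mem_image.1 hZ
    obtain ⟨ha, hb, hne⟩ := mem_offDiag.1 hab
    exact inter_mem_rainbowMeets ha hb hne

/-- Complements of joins of distinct members, and `∅ = F \ F`, are rainbow meets: the complemented-join family is at least as large as `{F} ∪ joins`.
[this work] -/
theorem card_insert_top_image_union_le_card_rainbowMeets (F : Finset α) (P : Finset (Finset α)) (hPF : ∀ S ∈ P, S ⊆ F) :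
    #(insert F (P.offDiag.image fun pq => pq.1 ∪ pq.2)) ≤ #(rainbowMeets F P) := by
  -- complementation inside `F` is injective on subsets of `F`
  set J := insert F (P.offDiag.image fun pq => pq.1 ∪ pq.2) with hJ
  have hsub : ∀ W ∈ J, W ⊆ F := by
    intro W hW
    rcases mem_insert.1 hW with rfl | hW
    · exact Subset.rfl
    · obtain ⟨⟨a, b⟩, hab, rfl⟩ := mem_image.1 hW
      obtain ⟨ha, hb, _⟩ := mem_offDiag.1 hab
      exact union_subset (hPF a ha) (hPF b hb)
  have hinj : Set.InjOn (fun W => F \ W) (J : Set (Finset α)) := by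
    intro W hW W' hW' h
    simp only [mem_coe] at hW hW'
    have e1 : F \ (F \ W) = W := Finset.sdiff_sdiff_eq_self (hsub W hW)
    have e2 : F \ (F \ W') = W' := Finset.sdiff_sdiff_eq_self (hsub W' hW')
    have : F \ (F \ W) = F \ (F \ W') := by simp only [h]
    rwa [e1, e2] at this
  rw [← card_image_of_injOn hinj]
  apply card_le_card
  intro Z hZ
  obtain ⟨W, hW, rfl⟩ := mem_image.1 hZ
  rcases mem_insert.1 hW with rfl | hW
  · have e : W \ W = (∅ : Finset α) := sdiff_eq_empty_iff_subset.2 Subset.rfl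
    rw [e]
    exact mem_rainbowMeets_iff.2 (Or.inl rfl)
  · obtain ⟨⟨a, b⟩, hab, rfl⟩ := mem_image.1 hW
    obtain ⟨ha, hb, hne⟩ := mem_offDiag.1 hab
    exact sdiff_union_mem_rainbowMeets ha hb hne

/-- **`AntichainMeetsOrJoins` ⟹ the rainbow lemma for antichains.** [this work] -/
theorem card_le_card_rainbowMeets_of_antichainMeetsOrJoins (h : AntichainMeetsOrJoins α) (F : Finset α) (P : Finset (Finset α))
    (hPF : ∀ S ∈ P, S ⊆ F) (hcf : ∀ S ∈ P, F \ S ∉ P) (hanti : IsAntichain (· ⊆ ·) (P : Set (Finset α))) :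
    #P ≤ #(rainbowMeets F P) := by
  rcases h F P hPF hcf hanti with h | h
  · exact h.trans (card_le_card (insert_empty_image_inter_subset_rainbowMeets F P))
  · exact h.trans (card_insert_top_image_union_le_card_rainbowMeets F P hPF)

/-- In an antichain with at least two members every member is isolated. [this work] -/
theorem isoMembers_eq_of_isAntichain {P : Finset (Finset α)} (hanti : IsAntichain (· ⊆ ·) (P : Set (Finset α))) :
    isoMembers P = P := by
  apply Subset.antisymm (isoMembers_subset P)
  intro a ha
  refine mem_isoMembers_iff.2 ⟨ha, fun b hb hba h => ?_⟩
  rcases h with h | h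
  · exact hanti (mem_coe.2 ha) (mem_coe.2 hb) (Ne.symm hba) h
  · exact hanti (mem_coe.2 hb) (mem_coe.2 ha) hba h

end Summit.CriticalPhenomena.PercolationContinuityZ3.Theorems.SahiColouredDaykin
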